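import Mathlib.Tactic.Linarith
import Mathlib.Tactic.NormNum
import Mathlib.Tactic.Ring
import Mathlib.Tactic.IntervalCases
import HarnessLib

/-!
# The (0,1) cell of the ι-window, XXXVII: the product ground `B₁ × B₂`, XXIV — THE CORNER IX (report [XXXVII] `H2-ZERO-ONE-37.md`):
# arithmetic shadows of LEMMA HS-SIGN / THEOREM SECTION-ALL, COROLLARY FAR-0, LEMMA LEDGER / COROLLARY RHO-4, PROPOSITION ATT,
# PROPOSITION GRAPH-FIBRE and the EXAMPLE (2,2)

Family `hodge`, b2b cell `hweil` (helper of item stmt-HodgeConjecture-2524). Report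
`run/shared/lean/b2b/hodge-weil/b2b-hweil-pv1-g49/H2-ZERO-ONE-37.md` ([XXXVII]). Context (the words are the report's, nothing of them is formalised
here): for a Hartshorne–Serre partner `𝓠` on `H = B₁ × C₂` the class `e′` is `ι`-invariant for the induced linearisations ([XXXIV] 3.0), hence the
identification `ω_{W′} ≅ Ω|_{W′}` is `ι`-equivariant on the nose and the canonical linearisation of `Ω(4S)` acts by `+1` at all 96 fixed points
(LEMMA HS-SIGN); so the section of [XXXVI] 11.3 is invariant and `D ≥ 0` for EVERY partner (THEOREM SECTION-ALL: the hypothesis (H11.3) is retired,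
all closures of THEOREM II-VOID-Ω⁺ are unconditional); a fixed far fibre of multiplicity `m₀ ≥ 3` carries `≥ m₀(d₃−3)/2` invariant functions
(COROLLARY FAR-0: no far component for `d₃ ≥ 4`); the Ω-bound is an exact ledger over components with weights `w = (ρ−4)β + (d₃−3)α` and
per-block deficits `1 + [b ≥ 2] − b/2` (LEMMA LEDGER); at `ρ = 4` the 45 residual type-1 cells `(7, d₃ ≥ 4, 21, a₂)` need `P = 14`
(or `d₃ = 4`, `P = 13`). The theorems below are the integer / sign identities behind these statements. None of the theorems claims geometry.
HONEST FRAMING: census work inside the ladder's H2 test ((0,1) cell) on the SPECIAL fourfold `X₀`; nothing here is a rung; no case of the Hodge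
conjecture is proved; no statement of [Markman 2025] / [Perry 2026] / [EdGFS 2025] is used.
-/

-- mandated namespace `Summit.HodgeConjecture.HodgeConjecture.…` (Problem = Summit) trips `linter.dupNamespace`; the lakefile disables it
-- tree-wide (weak option), restated here so stand-alone elaboration is warning-free too.
set_option linter.dupNamespace false

namespace Summit.HodgeConjecture.HodgeConjecture.WeilTypeLadder

section ProductGroundTwentyFour

/-- **[XXXVII] 2.1 (LEMMA HS-SIGN, the character bookkeeping at a fixed point).** Signs are `±1` integers. At a point `p ∈ W′ ∩ H[2]` with
eigen-generators of characters `e₁, e₂` and `𝓑′(p)` of character `cB`, the Koszul model gives `𝓐′(p)` the character `cA = e₁e₂·cB`; tracelessness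
is `e₁ = −e₂`; then `cA·cB = −1`, the canonical character of `Ω(p) = ω_H(p) ⊗ 𝓑′(p) ⊗ 𝓐′(p)⁻¹` is `(−1)·cB·cA = +1`, that of `ω_{W′}(p)` is
`−e₁e₂ = +1`, and the local class `loc(e′)(p)` has character `(e₁e₂)·cB·cA = +1` (invariant). At a fixed point off `W′`, tracelessness is
`cA + cB = 0` and again `(−1)·cB·cA = +1`. [case split, `norm_num`] -/
theorem pg24_hs_sign_characters :
    (∀ e₁ e₂ cB : ℤ, (e₁ = 1 ∨ e₁ = -1) → (e₂ = 1 ∨ e₂ = -1) → (cB = 1 ∨ cB = -1) → e₁ = -e₂ →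
      (e₁ * e₂ * cB) * cB = -1 ∧ (-1) * cB * (e₁ * e₂ * cB) = 1 ∧ -(e₁ * e₂) = 1 ∧ (e₁ * e₂) * cB * (e₁ * e₂ * cB) = 1) ∧
    (∀ cA cB : ℤ, (cA = 1 ∨ cA = -1) → (cB = 1 ∨ cB = -1) → cA + cB = 0 → (-1) * cB * cA = 1) := by
  refine ⟨?_, ?_⟩
  · intro e₁ e₂ cB h₁ h₂ hB ht
    rcases h₁ with rfl | rfl <;> rcases h₂ with rfl | rfl <;> rcases hB with rfl | rfl <;>
      first | (exfalso; revert ht; decide) | norm_num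
  · intro cA cB hA hB h
    rcases hA with rfl | rfl <;> rcases hB with rfl | rfl <;>
      first | (exfalso; revert h; decide) | norm_num

/-- **[XXXVII] 2.3–2.4 (THEOREM SECTION-ALL, the counts).** Type 1: the 159 closures of [XXXVI] II-VOID-Ω⁺ were 92 unconditional + 67 under
(H11.3) (`(7,4): 12, (7,5): 12, (8,3): 15, (8,4): 17, (8,5): 11`); all 159 are now unconditional; the residual `224 − 159 = 65 = 17 + 45 + 3`
is unchanged in number. Other rows: the formerly conditional closures number `74, 84, 83, 75, 85, 85, 85` (RB-22 types 2–8) and `50, 54, 52, 55`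
(EZ₁); open counts `282 − 210 = 72`, `255 − 238`, `260 − 241`, `326 − 244`, `297 − 280`, `291 − 274`, `303 − 286`; EZ₁ `150 − 134`, `192 − 180`,
`219 − 205`, `221 − 210`. [`norm_num`] -/
theorem pg24_section_all_counts :
    (92 + 67 = 159 ∧ 224 - 159 = 65 ∧ 17 + 45 + 3 = 65 ∧ 12 + 12 + 15 + 17 + 11 = 67) ∧
    (74 + 84 + 83 + 75 + 85 + 85 + 85 = 571 ∧ 50 + 54 + 52 + 55 = 211) ∧
    (282 - 210 = 72 ∧ 255 - 238 = 17 ∧ 260 - 241 = 19 ∧ 326 - 244 = 82 ∧ 297 - 280 = 17 ∧ 291 - 274 = 17 ∧ 303 - 286 = 17) ∧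
    (150 - 134 = 16 ∧ 192 - 180 = 12 ∧ 219 - 205 = 14 ∧ 221 - 210 = 11) := by
  norm_num

/-- **[XXXVII] 2.5 (EXAMPLE (2,2)).** `B := π⁻¹`(graph of a general Möbius map) for the `(ℤ/2)²`-quotient `π : C₁ × C₂ → ℙ¹ × ℙ¹`: a Galois cover
of `ℙ¹` of degree 4 with 12 branch points of index 2, so `χ_top(B) = 4·2 − 12·2 = −16`, `g(B) = 9`; the S-class is `(v,h) = (2,2)` with
`p_a = vh + v + h + 1 = 9 = g` (smooth) and `B² = 2vh = 8`; `|K₁ ⊠ K₂|` has dimension `2·2 = 4 = h⁰(𝒪(1,1))`. [`norm_num`] -/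
theorem pg24_example_two_two :
    (4 : ℤ) * 2 - 12 * 2 = -16 ∧ ((2 : ℤ) - (-16)) / 2 = 9 ∧
    (∀ v h : ℤ, v = 2 → h = 2 → v * h + v + h + 1 = 9 ∧ 2 * v * h = 8) ∧ (2 * 2 = 4 ∧ (1 + 1) * (1 + 1) = 4) := by
  refine ⟨by norm_num, by norm_num, ?_, by norm_num⟩
  intro v h hv hh; subst hv; subst hh; norm_num

/-- **[XXXVII] 3.1 (COROLLARY FAR-0).** A fixed far fibre `Y₀` of multiplicity `m₀` has `χ(𝒪_{Y₀}) = m₀(d₃ − 3)` and Lefschetz number `0`, so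
`h⁰(𝒪_{Y₀})⁺ ≥ m₀(d₃−3)/2`; with `e := d₃ − 3`: `m₀ ≥ 3, e ≥ 1 ⟹ m₀e ≥ 3` (so the integer `h⁰⁺ ≥ ⌈m₀e/2⌉ ≥ 2`), and `m₀ = 2, e ≥ 2 ⟹ m₀e ≥ 4`.
Also the integer rounding: `2k ≥ 3 ⟹ k ≥ 2`. [`Nat.mul_le_mul`, `omega`] -/
theorem pg24_far_zero :
    (∀ m₀ e : ℕ, 3 ≤ m₀ → 1 ≤ e → 3 ≤ m₀ * e) ∧ (∀ e : ℕ, 2 ≤ e → 4 ≤ 2 * e) ∧ (∀ k : ℕ, 3 ≤ 2 * k → 2 ≤ k) := by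
  refine ⟨?_, ?_, ?_⟩
  · intro m₀ e h₁ h₂
    calc 3 = 3 * 1 := by norm_num
      _ ≤ m₀ * e := Nat.mul_le_mul h₁ h₂
  · intro e he; omega
  · intro k hk; omega

/-- **[XXXVII] 4.1–4.2 (LEMMA LEDGER / COROLLARY RHO-4).** (i) The doubled per-block deficit `2(1 + [b ≥ 2]) − b`: `1` at `b = 1`, `2, 1, 0` at
`b = 2, 3, 4`, negative for `b ≥ 5`. (ii) `MAIN(7, d₃) = ¼[(2d₃ − 6)·28 + (2·7 − 10 − 4)·(68 + 8d₃)] = 14(d₃ − 3)` and the cycle / `P′` numbers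
at `(n₃, a₁) = (7, 21)`: `W′·f′ = 70 − 2·7·3 = 28`, `W′·S = 2(62 − 7(4 − d₃) − 3d₃) = 68 + 8d₃`, `|P′| = 2·62 + 2·11(a₂ − 2) − 40 = 40 + 22a₂`;
h′ = 0: `|P′| − W′·S = 14d₃ − 28 ≥ 112` for `d₃ ≥ 10`. (iii) `(d₃ − 3)(14 − P) ≤ 1` with `4 ≤ d₃`, `7 ≤ P ≤ 14` forces `P = 14` or `(d₃, P) = (4, 13)`.
[`omega`, `ring`, `interval_cases`] -/
theorem pg24_ledger_rho_four :
    ((2 : ℤ) * 1 - 1 = 1 ∧ (2 : ℤ) * 2 - 2 = 2 ∧ (2 : ℤ) * 2 - 3 = 1 ∧ (2 : ℤ) * 2 - 4 = 0 ∧ ∀ b : ℤ, 5 ≤ b → 2 * 2 - b < 0) ∧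
    (∀ d₃ : ℤ, (2 * d₃ - 6) * 28 + (2 * 7 - 10 - 4) * (68 + 8 * d₃) = 4 * (14 * (d₃ - 3)) ∧
      (70 : ℤ) - 2 * 7 * (10 - 7) = 28 ∧ 2 * (62 - 7 * (4 - d₃) - (10 - 7) * d₃) = 68 + 8 * d₃) ∧
    (∀ a₂ : ℤ, 2 * 62 + 2 * (21 - 10) * (a₂ - 2) - 4 * 10 = 40 + 22 * a₂) ∧
    (∀ d₃ : ℤ, 10 ≤ d₃ → 112 ≤ (40 + 22 * d₃) - (68 + 8 * d₃)) ∧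
    (∀ d₃ P : ℕ, 4 ≤ d₃ → 7 ≤ P → P ≤ 14 → (d₃ - 3) * (14 - P) ≤ 1 → P = 14 ∨ (d₃ = 4 ∧ P = 13)) := by
  refine ⟨⟨by norm_num, by norm_num, by norm_num, by norm_num, fun b hb => by omega⟩, ?_, fun a₂ => by ring, fun d₃ h => by omega, ?_⟩
  · intro d₃; exact ⟨by ring, by norm_num, by ring⟩
  · intro d₃ P hd hP₁ hP₂ h
    interval_cases P <;> omega

/-- **[XXXVII] 4.4 (PROPOSITION ATT, the thresholds).** A free pair of attached fibres of multiplicity `m`, attached to B-horizontal components of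
total multiplicity `M` over its base point, in a (0,1) object: `m(2e − M) ≤ 2` (`e = d₃ − 3`); for `m = 2` this is `2e ≤ M + 1`, for `m = 3, 4, 5`
it is `2e ≤ M`. [`omega`] -/
theorem pg24_att_thresholds :
    (∀ e M : ℕ, 2 * (2 * e) ≤ 2 + 2 * M ↔ 2 * e ≤ M + 1) ∧ (∀ e M : ℕ, 3 * (2 * e) ≤ 2 + 3 * M ↔ 2 * e ≤ M) ∧
    (∀ e M : ℕ, 4 * (2 * e) ≤ 2 + 4 * M ↔ 2 * e ≤ M) ∧ (∀ e M : ℕ, 5 * (2 * e) ≤ 2 + 5 * M ↔ 2 * e ≤ M) := by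
  refine ⟨fun e M => by omega, fun e M => by omega, fun e M => by omega, fun e M => by omega⟩

/-- **[XXXVII] 4.6 (PROPOSITION GRAPH-FIBRE, the chain numerics).** One-block structures of multiplicity `m` on a vertical S-fibre: isolated ones have
`ε_{m−1} = 2d₃ − 4` and `Σ_{j=1}^{m−1} ε_j = (m/2)(2d₃ − 4) = m(d₃ − 2)`; monomial structures need `(m − 1) ∣ (2d₃ − 4)` (e.g. `d₃ = 4`: `m ∈ {2,3,5}`;
`d₃ = 5`: `m ∈ {2,3,4,7}`); traceless parity: `k_{m−1} ≡ m (mod 2)` while `D_{m−1} = 2D_{(m−1)/2}` has even multiplicities — impossible for odd `m`.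
The deficiency of the second layer, `ε₁ ≤ (2d₃ − 4)/(m − 1)`, reaches the 'collapse' threshold `2(d₃ − 3)` only for `m = 2` when `d₃ ≥ 5`:
`(m − 1)·2(d₃ − 3) ≤ 2d₃ − 4` with `m ≥ 3` forces `d₃ ≤ 4`. [`ring`, `decide`, `omega`] -/
theorem pg24_graph_fibre :
    (∀ m d₃ : ℤ, m * (2 * d₃ - 4) = 2 * (m * (d₃ - 2))) ∧
    ((2 * 4 - 4) % (2 - 1) = 0 ∧ (2 * 4 - 4) % (3 - 1) = 0 ∧ (2 * 4 - 4) % (5 - 1) = 0 ∧ (2 * 4 - 4) % (4 - 1) ≠ 0 ∧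
      (2 * 5 - 4) % (4 - 1) = 0 ∧ (2 * 5 - 4) % (7 - 1) = 0 ∧ (2 * 5 - 4) % (5 - 1) ≠ 0) ∧
    (∀ m k : ℕ, m % 2 = 1 → (2 * k) % 2 ≠ m % 2) ∧
    (∀ m d₃ : ℕ, 3 ≤ m → 5 ≤ d₃ → 2 * d₃ - 4 < (m - 1) * (2 * (d₃ - 3))) := by
  refine ⟨fun m d₃ => by ring, by decide, fun m k hm => by omega, ?_⟩
  intro m d₃ hm hd
  have h1 : 2 ≤ m - 1 := by omega
  have h2 : 2 * (2 * (d₃ - 3)) ≤ (m - 1) * (2 * (d₃ - 3)) := Nat.mul_le_mul_right _ h1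
  omega

/-- **[XXXVII] 4.3 (the three boundary cells and MAIN at d₃ = 3).** With `d₃ = 3` every weight is `(ρ − 4)β`, so `MAIN = (ρ − 4)·W′·S/4`:
`(8,3)`: `ρ = 6`, `W′·S = 2(62 − 8 − 2·3) = 96`, `MAIN = 48 = 25·3 − 27`; `(9,3)`: `ρ = 8`, `W′·S = 100`, `MAIN = 100 = 42·3 − 26`; `(7,3)`:
`ρ = 4`, `MAIN = 0`, and `Ω(4S)` has classes `(10 − 14, 6 − 2·3) = (−4 + 4, 0)` after the twist: numerically trivial. The (0,1) condition
`MAIN − (ρ − 4)P_h ≤ 1` with `h′ ≤ P_h ≤ 2h′`: `(8,3,19,15)`: `P_h = 24`; `(8,3,19,16)`: `P_h ∈ {24,25,26}`; `(9,3,19,16)`: `P_h ∈ {25, 26}`.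
[`norm_num`, `omega`] -/
theorem pg24_boundary_cells :
    ((2 : ℤ) * (62 - 8 * 1 - 2 * 3) = 96 ∧ (6 - 4) * 96 / 4 = (48 : ℤ) ∧ (25 : ℤ) * 3 - 27 = 48 ∧
      (2 : ℤ) * (62 - 9 * 1 - 1 * 3) = 100 ∧ (8 - 4) * 100 / 4 = (100 : ℤ) ∧ (42 : ℤ) * 3 - 26 = 100 ∧
      (2 : ℤ) * 7 - 10 = 4 ∧ (10 : ℤ) - 14 + 4 = 0 ∧ (6 : ℤ) - 2 * 3 = 0) ∧
    (∀ P : ℕ, 12 ≤ P → P ≤ 24 → (48 - 2 * P ≤ 1 ↔ P = 24)) ∧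
    (∀ P : ℕ, 13 ≤ P → P ≤ 26 → (48 - 2 * P ≤ 1 ↔ 24 ≤ P)) ∧
    (∀ P : ℕ, 13 ≤ P → P ≤ 26 → ((100 : ℤ) - 4 * P ≤ 1 ↔ 25 ≤ P)) := by
  refine ⟨by norm_num, fun P h₁ h₂ => by omega, fun P h₁ h₂ => by omega, fun P h₁ h₂ => by omega⟩

end ProductGroundTwentyFour

end Summit.HodgeConjecture.HodgeConjecture.WeilTypeLadder
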